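import Mathlib
import HarnessLib
import Summits.ResolutionOfSingularities.ResolutionOfSingularities.Theorems.WildQuotientsWildQuotientResolutionS1aMemberChartSec
import Summits.ResolutionOfSingularities.ResolutionOfSingularities.Theorems.WildQuotientsWildQuotientResolutionS1aMemberAwayTransfer

/-!
# S1a — R4c cusp, brick (b3′-core): A PRINCIPAL-CENTRE MEMBER CHART ON AN INVARIANT BASIC OPEN `D(b)` OF A NODE CHART (`exists_principalCentreChartSec_of_memberAway`)

[OURS · L1 W4.5c · lead-1 g17; plan-1 RULING R-F15v (2) ★ R4c `cusp_killsIn_two`, memo `Cruxes/CyclicQuotientFourfolds/Lines/s1a_logminvertex-R4c-PROGRESS.md` §2/§4 (b3′):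
the cusp's member charts are PROPER invariant basic opens `U = W ∩ D(b)` of producer charts `W`. ABSTRACT over the node data `DW` of `W` (so that the heavy producer
node `(ChartRing, chartNodeGrading, sigmaChart, E)` enters only as ONE structure literal at assembly time): given a pinned model `Φ : DW.B ≃ k[s,x′][1/q]`, an element
`b` with `DW.σ (DW.e b) = DW.e b` and a localised model `Φ′ : DW.B[1/DW.e b] ≃ k[s,x′][1/(q b′)]` with its pin (✓`FreeModel.exists_awayModelEquiv`), the ROWS of
`conj Φ DW.σ` on the member variables (polynomial identities in `k[s,x′][1/q]`), units / K1′ / Veronese degree in `k[s,x′][1/(q b′)]` and degrees for `DW.𝒜`, this file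
produces the principal-centre chart structure of the member `(x′₀ : 2, φ : 1)` on `D(b)` with the trace formula on every affine `U ≤ D(b)` — node of `D(b)` by
✓`NodeChartAway.exists_nodeData_basicOpen`, transfers ✓`FreeModel.conj_away_algebraMap` / `conj_away_fix` / `algebraMap_mem_mapGrading_away`, then
✓`exists_principalCentreChartSec_of_symMemberGraph`. Also `NodeData.actO_eq_self_of_fixed` and `exists_veroneseNormalised_memberAway`] — NOT statements of the manuscript;
counted 0; AI-level work, weaker than expert review. Crux stmt-ResolutionOfSingularities-17941 `CyclicQuotientFourfolds`, line `s1a-logminvertex` v13 (`stub_reachLowerInFX`).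
-/

set_option linter.dupNamespace false

noncomputable section

open CategoryTheory Limits AlgebraicGeometry TopologicalSpace Topology Opposite MvPolynomial
open Literature.AlgebraicGeometry.Resolution Literature.AlgebraicGeometry.RelativeSpec
open scoped LaurentPolynomial
open Summit.ResolutionOfSingularities.ResolutionOfSingularities.Theorems.WildQuotientResolution.S1
open Summit.ResolutionOfSingularities.ResolutionOfSingularities.Theorems.WildQuotientResolution.S1.NodeAtlas
open Summit.ResolutionOfSingularities.ResolutionOfSingularities.Theorems.WildQuotientResolution.S1.ProducerStep
open Summit.ResolutionOfSingularities.ResolutionOfSingularities.Theorems.WildQuotientResolution.S1.CoarseChart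
open Summit.ResolutionOfSingularities.ResolutionOfSingularities.Theorems.WildQuotientResolution.S1.NodeTransport
open Summit.ResolutionOfSingularities.ResolutionOfSingularities.Theorems.WildQuotientResolution.S1.KillCert
open Summit.ResolutionOfSingularities.ResolutionOfSingularities.Theorems.WildQuotientResolution.S1.BlowupCharts
open Summit.ResolutionOfSingularities.ResolutionOfSingularities.Theorems.WildQuotientResolution.S1.NpFrame
open Summit.ResolutionOfSingularities.ResolutionOfSingularities.Theorems.WildQuotientResolution.S1.NodeAway
open Summit.ResolutionOfSingularities.ResolutionOfSingularities.Theorems.WildQuotientResolution.S1.FreeModel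
open Summit.ResolutionOfSingularities.ResolutionOfSingularities.Theorems.WildQuotientResolution.S1.GoodCharts
open Summit.ResolutionOfSingularities.ResolutionOfSingularities.Theorems.WildQuotientResolution.S1.GameFrame.GModel

namespace Summit.ResolutionOfSingularities.ResolutionOfSingularities.Theorems.WildQuotientResolution.S1.GameFrame.GModel

variable {p : ℕ} {X' X₁ : Scheme.{0}} {q : X' ⟶ X₁} {G : Type} [Group G] {ρ : G →* Aut X'} {g₀ : G}

/-- **A section whose node image is `σ`-fixed is `G`-invariant** (`G = ⟨g₀⟩`), from the intertwining of the node data. [OURS · L1 W4.5c] -/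
theorem NodeData.actO_eq_self_of_fixed (hG : ∀ g : G, g ∈ Subgroup.zpowers g₀) (M : GModel p q G ρ g₀) (W : M.act.StableAffineOpens)
    (DW : NodeData p M.act g₀ W) (b : Γ(M.V, W.1))
    (hσb : letI := DW.instCommRing; letI := DW.instGradedRing; DW.σ ((DW.e b : ↥(DW.𝒜 0)) : DW.B) = (DW.e b : ↥(DW.𝒜 0))) : ∀ g : G, actO M.act W g b = b := by
  letI := DW.instCommRing
  letI := DW.instGradedRing
  have hfix₀ : (M.act.aut g₀⁻¹).hom.appLE W.1 W.1 (W.2.1 g₀⁻¹).ge b = b :=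
    DW.e.injective (Subtype.ext (by rw [← hσb]; exact DW.intertwine b))
  intro g
  exact appLE_aut_eq_self_of_mem_zpowers M.act W.1 W.2.1 hfix₀ (by rw [Subgroup.zpowers_inv]; exact hG g⁻¹)

section MemberAway

variable {k : Type} [Field k] (hG : ∀ g : G, g ∈ Subgroup.zpowers g₀) (M : GModel p q G ρ g₀) (W : M.act.StableAffineOpens) (DW : NodeData p M.act g₀ W)
  (qd b' : (MvPolynomial (Option (Fin 4)) k)) (Φ : letI := DW.instCommRing; letI := DW.instGradedRing; DW.B ≃+* Localization.Away qd) (b : Γ(M.V, W.1))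
  (hσb : letI := DW.instCommRing; letI := DW.instGradedRing; DW.σ ((DW.e b : ↥(DW.𝒜 0)) : DW.B) = ((DW.e b : ↥(DW.𝒜 0)) : DW.B))
  (Φ' : letI := DW.instCommRing; letI := DW.instGradedRing; (Localization.Away ((DW.e b : ↥(DW.𝒜 0)) : DW.B)) ≃+* Localization.Away (qd * b'))
  (hpin : letI := DW.instCommRing; letI := DW.instGradedRing; ∀ a : (MvPolynomial (Option (Fin 4)) k), Φ' (algebraMap DW.B (Localization.Away ((DW.e b : ↥(DW.𝒜 0)) : DW.B)) (Φ.symm ((algebraMap (MvPolynomial (Option (Fin 4)) k) (Localization.Away qd)) a))) = (algebraMap (MvPolynomial (Option (Fin 4)) k) (Localization.Away (qd * b'))) a)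

set_option maxHeartbeats 4000000 in
set_option synthInstance.maxHeartbeats 400000 in
include hσb hpin in
/-- **A Veronese degree for the member `(x′₀, φ)` on the LOCALISED chart `D(b)`**: from the degrees of `x′₀/1` and `φ/1` for `DW.𝒜` (tameness of the localised node
✓`isTameNode_away`). [OURS · L1 W4.5c · R4c] -/
theorem exists_veroneseNormalised_memberAway (φ : (MvPolynomial (Option (Fin 4)) k)) (θ₀ θ₁ : Π j : Fin DW.m, ZMod (DW.r j))
    (hX₀d : letI := DW.instCommRing; letI := DW.instGradedRing; (algebraMap (MvPolynomial (Option (Fin 4)) k) (Localization.Away qd)) (X (some 0)) ∈ mapGrading DW.𝒜 Φ θ₀) (hφd : letI := DW.instCommRing; letI := DW.instGradedRing; (algebraMap (MvPolynomial (Option (Fin 4)) k) (Localization.Away qd)) φ ∈ mapGrading DW.𝒜 Φ θ₁) (w' : Fin 2 → ℕ) :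
    letI := DW.instCommRing; letI := DW.instGradedRing
    letI := GradedLocalization.locGradedRing DW.𝒜 (DW.e b).2
    letI := mapGradedRing (GradedLocalization.locPiece DW.𝒜 (DW.e b).2) Φ'
    ∃ d : ℕ, VeroneseNormalised (mapGrading (GradedLocalization.locPiece DW.𝒜 (DW.e b).2) Φ') (![(algebraMap (MvPolynomial (Option (Fin 4)) k) (Localization.Away (qd * b'))) (X (some 0)), (algebraMap (MvPolynomial (Option (Fin 4)) k) (Localization.Away (qd * b'))) φ] : Fin 2 → Localization.Away (qd * b')) w' d := by
  letI := DW.instCommRing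
  letI := DW.instGradedRing
  letI instL := GradedLocalization.locGradedRing DW.𝒜 (DW.e b).2
  letI instP := mapGradedRing (GradedLocalization.locPiece DW.𝒜 (DW.e b).2) Φ'
  have htame' : IsTameNode p (Localization.Away ((DW.e b : ↥(DW.𝒜 0)) : DW.B)) (GradedLocalization.locPiece DW.𝒜 (DW.e b).2) (sigmaAway DW.σ hσb) := isTameNode_away DW.σ hσb DW.𝒜 (DW.e b).2 DW.tame
  have htameT := isTameNode_map (GradedLocalization.locPiece DW.𝒜 (DW.e b).2) Φ' p (sigmaAway DW.σ hσb) htame'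
  exact Veronese.veroneseNormalisation _ _ _ htameT.2.2.2.1 2 _ ![θ₀, θ₁] w'
    (fun i => by
      fin_cases i
      · exact algebraMap_mem_mapGrading_away qd b' Φ ((DW.e b : ↥(DW.𝒜 0)) : DW.B) Φ' hpin DW.𝒜 (DW.e b).2 (X (some 0)) hX₀d
      · exact algebraMap_mem_mapGrading_away qd b' Φ ((DW.e b : ↥(DW.𝒜 0)) : DW.B) Φ' hpin DW.𝒜 (DW.e b).2 φ hφd)

set_option maxHeartbeats 8000000 in
set_option synthInstance.maxHeartbeats 400000 in
include hpin in
/-- ★★ **THE MEMBER `(x′₀ : 2, φ : 1)` ON AN INVARIANT BASIC OPEN `D(b)` OF A NODE CHART, CHART LEVEL.** Rows of `τ′ = conj Φ DW.σ` in the producer model: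
`x_none, x′₀` fixed, `P₁ ↦ P₁ + Q₁·(x_none^δ x′₀)` (`Q₁` a unit on `D(b)`), `P₂ ↦ P₂ + Q₂·(x_none^δ x′₀)`, `x₃ ↦ x₃ + x_none^δ·T`, `φ ↦ φ + x_none^δ x′₀·HU + (x_none^δ x′₀)²·R`
(`HU` a unit on `D(b)`), `T = H·φ` (`H` a unit on `D(b)`), `τ′` fixing the constants and `q·b′`; `{x_none, x′₀, P₁, P₂, x₃}` generating the localised model with `(q b′)⁻¹` and
the constants; K1′ and the Veronese degree in the localised model; degrees for `DW.𝒜`. Conclusion: a principal-centre chart structure `𝒦₀` of Veronese degree `d` on `D(b)`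
with the trace formula of `(x′₀/1, φ/1; 2, 1)` on every affine `U ≤ D(b)`. [OURS · L1 W4.5c · R4c brick (b3′); NOT a statement of the manuscript] -/
theorem exists_principalCentreChartSec_of_memberAway
    (P₁ P₂ φ T H Q₁ Q₂ HU R : (MvPolynomial (Option (Fin 4)) k)) (δ : ℕ)
    (hs : letI := DW.instCommRing; letI := DW.instGradedRing; conj Φ DW.σ ((algebraMap (MvPolynomial (Option (Fin 4)) k) (Localization.Away qd)) (X none)) = (algebraMap (MvPolynomial (Option (Fin 4)) k) (Localization.Away qd)) (X none)) (h0 : letI := DW.instCommRing; letI := DW.instGradedRing; conj Φ DW.σ ((algebraMap (MvPolynomial (Option (Fin 4)) k) (Localization.Away qd)) (X (some 0))) = (algebraMap (MvPolynomial (Option (Fin 4)) k) (Localization.Away qd)) (X (some 0)))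
    (h1 : letI := DW.instCommRing; letI := DW.instGradedRing; conj Φ DW.σ ((algebraMap (MvPolynomial (Option (Fin 4)) k) (Localization.Away qd)) P₁) = (algebraMap (MvPolynomial (Option (Fin 4)) k) (Localization.Away qd)) (P₁ + Q₁ * (X none ^ δ * X (some 0))))
    (h2 : letI := DW.instCommRing; letI := DW.instGradedRing; conj Φ DW.σ ((algebraMap (MvPolynomial (Option (Fin 4)) k) (Localization.Away qd)) P₂) = (algebraMap (MvPolynomial (Option (Fin 4)) k) (Localization.Away qd)) (P₂ + Q₂ * (X none ^ δ * X (some 0))))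
    (h3 : letI := DW.instCommRing; letI := DW.instGradedRing; conj Φ DW.σ ((algebraMap (MvPolynomial (Option (Fin 4)) k) (Localization.Away qd)) (X (some 3))) = (algebraMap (MvPolynomial (Option (Fin 4)) k) (Localization.Away qd)) (X (some 3) + X none ^ δ * T))
    (hφ : letI := DW.instCommRing; letI := DW.instGradedRing; conj Φ DW.σ ((algebraMap (MvPolynomial (Option (Fin 4)) k) (Localization.Away qd)) φ) = (algebraMap (MvPolynomial (Option (Fin 4)) k) (Localization.Away qd)) (φ + X none ^ δ * X (some 0) * HU + (X none ^ δ * X (some 0)) ^ 2 * R))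
    (hC : letI := DW.instCommRing; letI := DW.instGradedRing; ∀ a : k, conj Φ DW.σ ((algebraMap (MvPolynomial (Option (Fin 4)) k) (Localization.Away qd)) (C a)) = (algebraMap (MvPolynomial (Option (Fin 4)) k) (Localization.Away qd)) (C a))
    (hq : letI := DW.instCommRing; letI := DW.instGradedRing; conj Φ DW.σ ((algebraMap (MvPolynomial (Option (Fin 4)) k) (Localization.Away qd)) (qd * b')) = (algebraMap (MvPolynomial (Option (Fin 4)) k) (Localization.Away qd)) (qd * b'))
    (hXR : T = H * φ) (hQ₁ : IsUnit ((algebraMap (MvPolynomial (Option (Fin 4)) k) (Localization.Away (qd * b'))) Q₁)) (hHU : IsUnit ((algebraMap (MvPolynomial (Option (Fin 4)) k) (Localization.Away (qd * b'))) HU)) (hH : IsUnit ((algebraMap (MvPolynomial (Option (Fin 4)) k) (Localization.Away (qd * b'))) H))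
    (hgen : Subring.closure (({(algebraMap (MvPolynomial (Option (Fin 4)) k) (Localization.Away (qd * b'))) (X none), (algebraMap (MvPolynomial (Option (Fin 4)) k) (Localization.Away (qd * b'))) (X (some 0)), (algebraMap (MvPolynomial (Option (Fin 4)) k) (Localization.Away (qd * b'))) P₁, (algebraMap (MvPolynomial (Option (Fin 4)) k) (Localization.Away (qd * b'))) P₂, (algebraMap (MvPolynomial (Option (Fin 4)) k) (Localization.Away (qd * b'))) (X (some 3))} : Set (Localization.Away (qd * b'))) ∪ (({IsLocalization.Away.invSelf (qd * b')} : Set (Localization.Away (qd * b'))) ∪ Set.range (algebraMap k (Localization.Away (qd * b'))))) = ⊤)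
    (hK1 : RingTheory.Sequence.IsRegular (Localization.Away (qd * b')) (List.ofFn (![(algebraMap (MvPolynomial (Option (Fin 4)) k) (Localization.Away (qd * b'))) (X (some 0)), (algebraMap (MvPolynomial (Option (Fin 4)) k) (Localization.Away (qd * b'))) φ] : Fin 2 → Localization.Away (qd * b'))))
    (hK1' : IsRegularRing (Localization.Away (qd * b') ⧸ Ideal.span (Set.range (![(algebraMap (MvPolynomial (Option (Fin 4)) k) (Localization.Away (qd * b'))) (X (some 0)), (algebraMap (MvPolynomial (Option (Fin 4)) k) (Localization.Away (qd * b'))) φ] : Fin 2 → Localization.Away (qd * b')))))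
    (θ₀ θ₁ : Π j : Fin DW.m, ZMod (DW.r j))
    (hX₀d : letI := DW.instCommRing; letI := DW.instGradedRing; (algebraMap (MvPolynomial (Option (Fin 4)) k) (Localization.Away qd)) (X (some 0)) ∈ mapGrading DW.𝒜 Φ θ₀) (hφd : letI := DW.instCommRing; letI := DW.instGradedRing; (algebraMap (MvPolynomial (Option (Fin 4)) k) (Localization.Away qd)) φ ∈ mapGrading DW.𝒜 Φ θ₁)
    (d : ℕ)
    (hver : letI := DW.instCommRing; letI := DW.instGradedRing; letI := GradedLocalization.locGradedRing DW.𝒜 (DW.e b).2; letI := mapGradedRing (GradedLocalization.locPiece DW.𝒜 (DW.e b).2) Φ'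
      VeroneseNormalised (mapGrading (GradedLocalization.locPiece DW.𝒜 (DW.e b).2) Φ') (![(algebraMap (MvPolynomial (Option (Fin 4)) k) (Localization.Away (qd * b'))) (X (some 0)), (algebraMap (MvPolynomial (Option (Fin 4)) k) (Localization.Away (qd * b'))) φ] : Fin 2 → Localization.Away (qd * b')) ![2, 1] d) :
    letI := DW.instCommRing; letI := DW.instGradedRing
    letI := GradedLocalization.locGradedRing DW.𝒜 (DW.e b).2
    letI := mapGradedRing (GradedLocalization.locPiece DW.𝒜 (DW.e b).2) Φ'
    ∃ 𝒦₀ : ReesFiltration M.V, IsPrincipalCentreChart p M.act g₀ 𝒦₀ d (NodeChartAway.basicOpenStable M.act W DW.affine (NodeData.actO_eq_self_of_fixed hG M W DW b hσb)) ∧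
      (∀ n, (𝒦₀.filtration ⟨(NodeChartAway.basicOpenStable M.act W DW.affine (NodeData.actO_eq_self_of_fixed hG M W DW b hσb)).1, NodeChartAway.isAffineOpen_basicOpenStable M.act W DW.affine (NodeData.actO_eq_self_of_fixed hG M W DW b hσb)⟩).ideal n =
        ((traceFiltration (mapGrading (GradedLocalization.locPiece DW.𝒜 (DW.e b).2) Φ') (![(algebraMap (MvPolynomial (Option (Fin 4)) k) (Localization.Away (qd * b'))) (X (some 0)), (algebraMap (MvPolynomial (Option (Fin 4)) k) (Localization.Away (qd * b'))) φ] : Fin 2 → Localization.Away (qd * b')) ![2, 1]).ideal n).comap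
          (((NodeChartAway.basicOpenNodeEquiv M.act W DW.affine b DW.𝒜 DW.e).trans (zeroRingEquiv (GradedLocalization.locPiece DW.𝒜 (DW.e b).2) Φ') : Γ(M.V, M.V.basicOpen b) ≃+* ↥(mapGrading (GradedLocalization.locPiece DW.𝒜 (DW.e b).2) Φ' 0)) : Γ(M.V, M.V.basicOpen b) →+* ↥(mapGrading (GradedLocalization.locPiece DW.𝒜 (DW.e b).2) Φ' 0))) ∧
      (∀ (U : M.V.affineOpens) (hU : U.1 ≤ (NodeChartAway.basicOpenStable M.act W DW.affine (NodeData.actO_eq_self_of_fixed hG M W DW b hσb)).1) (n : ℕ), (𝒦₀.filtration U).ideal n =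
        (((traceFiltration (mapGrading (GradedLocalization.locPiece DW.𝒜 (DW.e b).2) Φ') (![(algebraMap (MvPolynomial (Option (Fin 4)) k) (Localization.Away (qd * b'))) (X (some 0)), (algebraMap (MvPolynomial (Option (Fin 4)) k) (Localization.Away (qd * b'))) φ] : Fin 2 → Localization.Away (qd * b')) ![2, 1]).ideal n).comap
          (((NodeChartAway.basicOpenNodeEquiv M.act W DW.affine b DW.𝒜 DW.e).trans (zeroRingEquiv (GradedLocalization.locPiece DW.𝒜 (DW.e b).2) Φ') : Γ(M.V, M.V.basicOpen b) ≃+* ↥(mapGrading (GradedLocalization.locPiece DW.𝒜 (DW.e b).2) Φ' 0)) : Γ(M.V, M.V.basicOpen b) →+* ↥(mapGrading (GradedLocalization.locPiece DW.𝒜 (DW.e b).2) Φ' 0))).map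
          (M.V.presheaf.map (homOfLE hU).op).hom) := by
  letI := DW.instCommRing
  letI := DW.instGradedRing
  letI instL := GradedLocalization.locGradedRing DW.𝒜 (DW.e b).2
  letI instP := mapGradedRing (GradedLocalization.locPiece DW.𝒜 (DW.e b).2) Φ'
  -- the node of `D(b)`
  obtain ⟨hσb', htame', hE', -⟩ := NodeChartAway.exists_nodeData_basicOpen M.act W DW.affine (NodeData.actO_eq_self_of_fixed hG M W DW b hσb) DW.𝒜 DW.e g₀ DW.σ DW.tame DW.intertwine
  -- transferred rows
  have tr := fun a a' (h' : conj Φ DW.σ ((algebraMap (MvPolynomial (Option (Fin 4)) k) (Localization.Away qd)) a) = (algebraMap (MvPolynomial (Option (Fin 4)) k) (Localization.Away qd)) a') => conj_away_algebraMap qd b' Φ ((DW.e b : ↥(DW.𝒜 0)) : DW.B) DW.σ hσb Φ' hpin a a' h'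
  have hs' := tr _ _ hs
  have h0' := tr _ _ h0
  have h1' := tr _ _ h1
  have h2' := tr _ _ h2
  have h3' := tr _ _ h3
  have hφ' := tr _ _ hφ
  simp only [map_add, map_mul, map_pow] at h1' h2' h3' hφ'
  -- fixed set
  have hfix : ∀ g' ∈ (({IsLocalization.Away.invSelf (qd * b')} : Set (Localization.Away (qd * b'))) ∪ Set.range (algebraMap k (Localization.Away (qd * b')))), conj Φ' (sigmaAway DW.σ hσb) g' = g' := by
    rintro g' (hg | ⟨a, rfl⟩)
    · rw [Set.mem_singleton_iff.mp hg]
      exact conj_away_invSelf qd b' Φ ((DW.e b : ↥(DW.𝒜 0)) : DW.B) DW.σ hσb Φ' hpin hq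
    · rw [IsScalarTower.algebraMap_apply k (MvPolynomial (Option (Fin 4)) k) (Localization.Away (qd * b')) a, MvPolynomial.algebraMap_eq]
      exact tr _ _ (hC a)
  -- degrees
  have hX₀d' := algebraMap_mem_mapGrading_away qd b' Φ ((DW.e b : ↥(DW.𝒜 0)) : DW.B) Φ' hpin DW.𝒜 (DW.e b).2 (X (some 0)) hX₀d
  have hφd' := algebraMap_mem_mapGrading_away qd b' Φ ((DW.e b : ↥(DW.𝒜 0)) : DW.B) Φ' hpin DW.𝒜 (DW.e b).2 φ hφd
  have hXR' : (algebraMap (MvPolynomial (Option (Fin 4)) k) (Localization.Away (qd * b'))) T = (algebraMap (MvPolynomial (Option (Fin 4)) k) (Localization.Away (qd * b'))) H * (algebraMap (MvPolynomial (Option (Fin 4)) k) (Localization.Away (qd * b'))) φ := by rw [hXR, map_mul]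
  exact exists_principalCentreChartSec_of_symMemberGraph M (NodeChartAway.basicOpenStable M.act W DW.affine (NodeData.actO_eq_self_of_fixed hG M W DW b hσb))
    ({ affine := NodeChartAway.isAffineOpen_basicOpenStable M.act W DW.affine (NodeData.actO_eq_self_of_fixed hG M W DW b hσb), m := DW.m, r := DW.r, B := (Localization.Away ((DW.e b : ↥(DW.𝒜 0)) : DW.B)), 𝒜 := (GradedLocalization.locPiece DW.𝒜 (DW.e b).2), σ := (sigmaAway DW.σ hσb), e := (NodeChartAway.basicOpenNodeEquiv M.act W DW.affine b DW.𝒜 DW.e),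
       tame := htame', intertwine := hE' } : NodeData p M.act g₀ (NodeChartAway.basicOpenStable M.act W DW.affine (NodeData.actO_eq_self_of_fixed hG M W DW b hσb)))
    Φ' (conj Φ' (sigmaAway DW.σ hσb)) (fun _ => rfl)
    ((algebraMap (MvPolynomial (Option (Fin 4)) k) (Localization.Away (qd * b'))) (X none)) ((algebraMap (MvPolynomial (Option (Fin 4)) k) (Localization.Away (qd * b'))) (X (some 0))) ((algebraMap (MvPolynomial (Option (Fin 4)) k) (Localization.Away (qd * b'))) P₁) ((algebraMap (MvPolynomial (Option (Fin 4)) k) (Localization.Away (qd * b'))) P₂) ((algebraMap (MvPolynomial (Option (Fin 4)) k) (Localization.Away (qd * b'))) (X (some 3))) ((algebraMap (MvPolynomial (Option (Fin 4)) k) (Localization.Away (qd * b'))) φ) ((algebraMap (MvPolynomial (Option (Fin 4)) k) (Localization.Away (qd * b'))) T) ((algebraMap (MvPolynomial (Option (Fin 4)) k) (Localization.Away (qd * b'))) H) ((algebraMap (MvPolynomial (Option (Fin 4)) k) (Localization.Away (qd * b'))) Q₁) ((algebraMap (MvPolynomial (Option (Fin 4)) k) (Localization.Away (qd * b'))) Q₂)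 ((algebraMap (MvPolynomial (Option (Fin 4)) k) (Localization.Away (qd * b'))) HU) ((algebraMap (MvPolynomial (Option (Fin 4)) k) (Localization.Away (qd * b'))) R) δ (({IsLocalization.Away.invSelf (qd * b')} : Set (Localization.Away (qd * b'))) ∪ Set.range (algebraMap k (Localization.Away (qd * b'))))
    hs' h0' h1' h2' h3' hφ' hQ₁ hHU hXR' hH hfix hgen hK1 hK1' θ₀ θ₁ hX₀d' hφd' d hver

end MemberAway

end Summit.ResolutionOfSingularities.ResolutionOfSingularities.Theorems.WildQuotientResolution.S1.GameFrame.GModel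

end
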